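import Literature.NumberTheory.Automorphic.GLnSphericalHeckeAlgebraLeadingTerms
import Literature.NumberTheory.Automorphic.HeckeRingOfSubmonoid
import HarnessLib

/-!
# The integral spherical Hecke algebra of `GL_n(F)` is generated by the elementary operators over EVERY commutative ring:
# `span_R {K x K : x ∈ M_n(𝒪_F)} = R[c_{(1)}, …, c_{(1ⁿ)}]` and `ℋ(GL_n(F), GL_n(𝒪_F); R) = R[c_{(1^r)}, c_{(1ⁿ)}⁻¹]`
# (Macdonald Ch. V (2.3), (2.5)–(2.7); Tamagawa 1963; Shimura Thm. 3.20 for `F = ℚ_p`)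

Topic `NumberTheory/Automorphic`; namespace `Literature.NumberTheory.Automorphic` (lane `lit-hodgefound`, Track 2
foundations; seat `lit-hodgefound-p11`, generation 42, row g42-#3).  THEOREMS ONLY: no definition, no named fact, no
instance, no notation.  Sequel of `GLnSphericalHeckeAlgebraLeadingTerms` (g42-#2: bottom-term calculus of the counting
Satake transform, algebraic independence of the `c_{(1^r)}` over any `R`) and `CartanIwasawaUniquenessGL` (g42-#1:
Bruhat–Tits (4.4.4) (ii)); the `ℂ`-version of this file (leading TOP terms with non-zero coefficients `q^{…}`) is the
tree's `SatakeTransformGLAlgebraicIndependence` §4 (g41-#8), the `e = f = 1` version over any `k` is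
`PadicGLnSphericalHeckeAlgebraIntegralPart` (g41-#5).

## The print and the proof

[Macdonald1995] Ch. V (2.3) «The `c_λ` (resp. the `c_λ` such that `λ_n ≥ 0`) form a `ℤ`-basis of `H(G, K)` (resp.
`H(G⁺, K)`)», (2.5) «`H(G, K) = H(G⁺, K)[c_{(1ⁿ)}⁻¹]`», (2.6) `c_μ * c_ν = Σ_λ g^λ_{μν}(q) c_λ` (Hall polynomials: only
`λ ≤ μ + ν` occur, and `g^{μ+ν}_{μν} = 1`), (2.7) `θ : H(G⁺, K) → Λ_n[q⁻¹]` injective; with Ch. II (2.3)–(2.4)/(4.?)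
these give `H(G⁺, K) = ℤ[c_{(1)}, …, c_{(1ⁿ)}]` (Tamagawa).  INTEGRAL PROOF formalised here (any commutative `R`): by a
double induction — on the degree `|a| = Σ a_i` and, inside a degree, on the dominance position of `a` (the potential
`Σ_s Σ_{i<s} a_i`, which strict dominance raises and which is bounded by `(n+1)|a|`) — every Cartan double coset
`c_a = K ϖ^a K` with `a ∈ ℤⁿ` MONOTONE and `a ≥ 0` lies in `A = R[c_{(1)}, …, c_{(1ⁿ)}]`: with `i₀` the first index
where `a_{i₀} > 0`, `ε = (0^{i₀}, 1^{n-i₀})` (the monotone exponent of `c_{(1^{n-i₀})}`) and `a' = a - ε` (monotone,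
`≥ 0`, smaller degree, so `c_{a'} ∈ A`), the counting Satake transforms of `c_a` and of `c_{a'} c_{(1^{n-i₀})}` are both
co-triangular with bottom `a` and bottom coefficient `1` (g42-#1/#2); the difference `D` is an `R`-combination of
integral Cartan double cosets `c_b` (`b` monotone, `b ≥ 0`), and reading `𝒮_1(D) = Σ_b l_b 𝒮_1(c_b)` at dominance-minimal
exponents shows that every `b` with `l_b ≠ 0` is STRICTLY above `a`, of the same degree (§1: an abstract «support of
an expansion in co-triangular elements with unit bottom coefficients» lemma, plus its homogeneous version); hence
`c_b ∈ A` by the inner induction and `c_a = D + c_{a'} c_{(1^{n-i₀})} ∈ A`.  Then `span_R {K x K : x integral} = A`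
(Cartan decomposition with exponents in `ℕⁿ`, `HeckeRingOfSubmonoid`), and every `K g K` is `c_{ϖ^{-m} 1} · c_{ϖ^m g}`
with `ϖ^m g` integral and `c_{ϖ^{-m} 1} = (c_{ϖ⁻¹ 1})^m` central, so `ℋ = R[c_{(1^r)}, c_{ϖ⁻¹ 1}]` (Macdonald (2.5)).

## What is formalised (theorems only; `HS_s(μ)` = `∑ i, if (i : ℕ) < s then μ i else 0`)

* §1 (`R[ℤⁿ]`, any commutative `R`): `sum_ite_lt_eq_of_le`, `eq_of_forall_sum_ite_lt_le_le`,
  `sum_eq_add_of_coeff_mul_ne_zero` (degrees add), **`forall_sum_ite_lt_le_of_coeff_sum_smul_ne_zero`** (support of an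
  expansion `X = Σ_j l_j m_j` in co-triangular `m_j` with unit bottom coefficients: if all exponents of `X` are above `a`,
  every bottom with `l_j ≠ 0` is above `a`), **`sum_eq_of_coeff_sum_smul_ne_zero`** (homogeneous version: every bottom with
  `l_j ≠ 0` has the degree of `X`), `coeff_sum_smul_eq_mul_of_forall_le` (the coefficient of `X` at a bottom below all
  others), `sum_range_sum_ite_lt_le_of_nonneg` (potential `≤ (n+1)·degree`), `sum_range_sum_ite_lt_lt_of_forall_le_of_ne`
  (strict dominance raises the potential).
* §2 (`F` with `ValuativeRel`, `𝒪[F]` a DVR, `ϖ` uniformizing, `(GL_n(F), GL_n(𝒪))` a Hecke pair):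
  `sum_eq_sum_of_coeff_satakeTransform_zpowDiagGL_ne_zero` (`𝒮_w(c_a)` is homogeneous of degree `|a|`),
  `isIntegralMatrix_zpowDiagGL_of_nonneg`, `exists_monotone_nonneg_doubleCosetOperator_eq` (integral `x`: `K x K = K ϖ^b K`,
  `b` monotone `≥ 0`), `span_doubleCosetOperator_isIntegralMatrix_le_span_image`,
  `mul_mem_span_doubleCosetOperator_isIntegralMatrix`.
* §3 **`doubleCosetOperator_zpowDiagGL_mem_adjoin_of_monotone_of_nonneg`** (MAIN: `c_a ∈ R[c_{(1)}, …, c_{(1ⁿ)}]` for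
  `a` monotone `≥ 0`), `doubleCosetOperator_mem_adjoin_of_isIntegralMatrix`.
* §4 **`span_doubleCosetOperator_glInt_isIntegralMatrix_eq_toSubmodule_adjoin_of_commRing`** (MACDONALD (2.3)+(2.7)
  INTEGRALLY: `span_R {K x K : x ∈ M_n(𝒪_F)} = R[c_{(1^r)}]`), `adjoin_glInt_zpowDiagGL_eq_adjoin_isIntegralMatrix_of_commRing`,
  `doubleCosetOperator_zpowDiagGL_const_neg_eq_pow`, `doubleCosetOperator_zpowDiagGL_one_mul_neg_one_of_commRing`,
  `doubleCosetOperator_zpowDiagGL_neg_one_mul_one_of_commRing` ((2.5): `c_{(1ⁿ)}` is a unit),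
  **`adjoin_glInt_zpowDiagGL_insert_eq_top_of_commRing`** (`ℋ(GL_n(F), GL_n(𝒪_F); R) = R[c_{(1^r)}, c_{ϖ⁻¹ 1_n}]`).

## References
* [Macdonald1995] I. G. Macdonald, *Symmetric Functions and Hall Polynomials*, 2nd ed. (1995), Ch. V (2.2)–(2.7)
  (PDF pp. 244–246).
* [CartierCorvallis1979] P. Cartier, *Representations of 𝔭-adic groups: a survey*, PSPM 33.1 (1979), §IV Thm. 4.1, proof
  (b)–(c).
* [BruhatTits1972] F. Bruhat, J. Tits, *Groupes réductifs sur un corps local. I*, Publ. Math. IHÉS 41 (1972), Prop. (4.4.4).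
* [ShimuraIATAF1971] G. Shimura, *Introduction to the Arithmetic Theory of Automorphic Functions* (1971), Thm. 3.20.
-/

noncomputable section

open scoped MatrixGroups Pointwise
open ValuativeRel Matrix Finset MonoidAlgebra Representation MulAction

namespace Literature.NumberTheory.Automorphic

open Literature.NumberTheory.Automorphic.CartanUnique Literature.NumberTheory.Automorphic.HermitianLattice

/-! ## §1 Supports of expansions in co-triangular elements; degrees; the potential -/

section Abstract

variable {n : ℕ} {R : Type*} [CommRing R]

/-- Head sums beyond `n` are the total sum. [cite: Macdonald1995, Ch. I §1] -/
theorem sum_ite_lt_eq_of_le {μ : Fin n → ℤ} {t : ℕ} (ht : n ≤ t) :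
    (∑ i : Fin n, if (i : ℕ) < t then μ i else 0) = ∑ i : Fin n, if (i : ℕ) < n then μ i else 0 :=
  Finset.sum_congr rfl fun i _ => by rw [if_pos (lt_of_lt_of_le i.isLt ht), if_pos i.isLt]

/-- The dominance order is antisymmetric. [cite: Macdonald1995, Ch. I §1] -/
theorem eq_of_forall_sum_ite_lt_le_le {a b : Fin n → ℤ}
    (h₁ : ∀ t : ℕ, (∑ i : Fin n, if (i : ℕ) < t then a i else 0) ≤ ∑ i : Fin n, if (i : ℕ) < t then b i else 0)
    (h₂ : ∀ t : ℕ, (∑ i : Fin n, if (i : ℕ) < t then b i else 0) ≤ ∑ i : Fin n, if (i : ℕ) < t then a i else 0) : a = b :=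
  eq_of_forall_sum_ite_lt_eq fun t => le_antisymm (h₁ t) (h₂ t)

/-- Dominance for all `t` from dominance for `t ≤ n` (packaged as an inequality of vectors indexed by `Fin (n+1)`).
[cite: Macdonald1995, Ch. I §1] -/
theorem forall_sum_ite_lt_le_of_pi_le {a b : Fin n → ℤ}
    (h : (fun t : Fin (n + 1) => ∑ i : Fin n, if (i : ℕ) < (t : ℕ) then a i else 0) ≤
      fun t : Fin (n + 1) => ∑ i : Fin n, if (i : ℕ) < (t : ℕ) then b i else 0) (t : ℕ) :
    (∑ i : Fin n, if (i : ℕ) < t then a i else 0) ≤ ∑ i : Fin n, if (i : ℕ) < t then b i else 0 := by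
  by_cases ht : t ≤ n
  · exact h ⟨t, Nat.lt_succ_of_le ht⟩
  · rw [sum_ite_lt_eq_of_le (μ := a) (not_le.1 ht).le, sum_ite_lt_eq_of_le (μ := b) (not_le.1 ht).le]
    exact h ⟨n, Nat.lt_succ_self n⟩

/-- **Degrees add**: if every exponent of `f` (resp. `g`) has total `d₁` (resp. `d₂`), every exponent of `f g` has total
`d₁ + d₂`. [cite: Macdonald1995, Ch. V (2.6)] -/
theorem sum_eq_add_of_coeff_mul_ne_zero {f g : AddMonoidAlgebra R (Fin n → ℤ)} {d₁ d₂ : ℤ}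
    (hf : ∀ μ, f.coeff μ ≠ 0 → ∑ i, μ i = d₁) (hg : ∀ μ, g.coeff μ ≠ 0 → ∑ i, μ i = d₂)
    {μ : Fin n → ℤ} (hμ : (f * g).coeff μ ≠ 0) : ∑ i, μ i = d₁ + d₂ := by
  classical
  rw [AddMonoidAlgebra.coeff_mul, Finsupp.sum] at hμ
  obtain ⟨μ₁, hμ₁, h1⟩ := Finset.exists_ne_zero_of_sum_ne_zero hμ
  rw [Finsupp.sum] at h1
  obtain ⟨μ₂, hμ₂, h2⟩ := Finset.exists_ne_zero_of_sum_ne_zero h1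
  have h12 : μ₁ + μ₂ = μ := by
    by_contra h
    exact h2 (if_neg h)
  rw [← h12, ← hf μ₁ (Finsupp.mem_support_iff.1 hμ₁), ← hg μ₂ (Finsupp.mem_support_iff.1 hμ₂), ← Finset.sum_add_distrib]
  rfl

/-- **The coefficient of an expansion at a bottom below all others.**  If `X = Σ_{j ∈ s} l_j m_j` with `m_j`
co-triangular with bottom `bot j` (injective on `s`) and `bot j₀` is dominance-below every `bot j` with `l_j ≠ 0`, then
the coefficient of `x^{bot j₀}` in `X` is `l_{j₀} · (m_{j₀})_{bot j₀}`.
[cite: CartierCorvallis1979, §IV, proof of Thm. 4.1 (b)–(c)] [cite: Macdonald1995, Ch. V (2.6)–(2.7)] -/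
theorem coeff_sum_smul_eq_mul_of_forall_le {ι : Type*} (s : Finset ι) (l : ι → R)
    (m : ι → AddMonoidAlgebra R (Fin n → ℤ)) (bot : ι → Fin n → ℤ) (hbot : Set.InjOn bot s)
    (hsupp : ∀ j ∈ s, ∀ μ, (m j).coeff μ ≠ 0 →
      ∀ t : ℕ, (∑ i : Fin n, if (i : ℕ) < t then bot j i else 0) ≤ ∑ i : Fin n, if (i : ℕ) < t then μ i else 0)
    {j₀ : ι} (hj₀ : j₀ ∈ s)
    (hall : ∀ j ∈ s, l j ≠ 0 →
      ∀ t : ℕ, (∑ i : Fin n, if (i : ℕ) < t then bot j₀ i else 0) ≤ ∑ i : Fin n, if (i : ℕ) < t then bot j i else 0) :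
    (∑ j ∈ s, l j • m j).coeff (bot j₀) = l j₀ * (m j₀).coeff (bot j₀) := by
  classical
  simp only [AddMonoidAlgebra.coeff_sum, AddMonoidAlgebra.coeff_smul, Finsupp.coe_finsetSum, Finsupp.coe_smul,
    Finset.sum_apply, Pi.smul_apply, smul_eq_mul]
  rw [Finset.sum_eq_single_of_mem j₀ hj₀]
  intro j hj hne
  by_cases hl0 : l j = 0
  · rw [hl0, zero_mul]
  by_cases hm0 : (m j).coeff (bot j₀) = 0
  · rw [hm0, mul_zero]
  exfalso
  exact hne (hbot hj hj₀ (eq_of_forall_sum_ite_lt_le_le (hsupp j hj _ hm0) (hall j hj hl0)))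

/-- **Support of an expansion in co-triangular elements with UNIT bottom coefficients.**  If `X = Σ_{j ∈ s} l_j m_j`,
each `m_j` co-triangular with bottom `bot j` (injective on `s`) and unit bottom coefficient, and every exponent of `X` is
dominance-above `a`, then every `bot j` with `l_j ≠ 0` is dominance-above `a` (look at the coefficient of `X` at a
dominance-minimal bottom below `bot j`: it is `l · unit ≠ 0`).  The mirror image, over any commutative ring, of the tree's
`ℂ`-argument with tops. [cite: CartierCorvallis1979, §IV, proof of Thm. 4.1 (b)–(c)] [cite: Macdonald1995, Ch. V (2.6)–(2.7)] -/
theorem forall_sum_ite_lt_le_of_coeff_sum_smul_ne_zero {ι : Type*} (s : Finset ι) (l : ι → R)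
    (m : ι → AddMonoidAlgebra R (Fin n → ℤ)) (bot : ι → Fin n → ℤ) (hbot : Set.InjOn bot s)
    (hsupp : ∀ j ∈ s, ∀ μ, (m j).coeff μ ≠ 0 →
      ∀ t : ℕ, (∑ i : Fin n, if (i : ℕ) < t then bot j i else 0) ≤ ∑ i : Fin n, if (i : ℕ) < t then μ i else 0)
    (hlead : ∀ j ∈ s, IsUnit ((m j).coeff (bot j))) (a : Fin n → ℤ)
    (hX : ∀ μ, (∑ j ∈ s, l j • m j).coeff μ ≠ 0 →
      ∀ t : ℕ, (∑ i : Fin n, if (i : ℕ) < t then a i else 0) ≤ ∑ i : Fin n, if (i : ℕ) < t then μ i else 0)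
    {j : ι} (hj : j ∈ s) (hlj : l j ≠ 0) (t : ℕ) :
    (∑ i : Fin n, if (i : ℕ) < t then a i else 0) ≤ ∑ i : Fin n, if (i : ℕ) < t then bot j i else 0 := by
  classical
  -- the indices with non-zero coefficient whose bottom is below `bot j`
  set T := (s.filter fun x => l x ≠ 0).filter fun x =>
    (fun t : Fin (n + 1) => ∑ i : Fin n, if (i : ℕ) < (t : ℕ) then bot x i else 0) ≤
      fun t : Fin (n + 1) => ∑ i : Fin n, if (i : ℕ) < (t : ℕ) then bot j i else 0 with hT
  have hjT : j ∈ T := Finset.mem_filter.2 ⟨Finset.mem_filter.2 ⟨hj, hlj⟩, le_rfl⟩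
  obtain ⟨j₀, hj₀T, hmin⟩ := T.exists_minimalFor (fun x => fun t : Fin (n + 1) =>
    ∑ i : Fin n, if (i : ℕ) < (t : ℕ) then bot x i else 0) ⟨j, hjT⟩
  obtain ⟨hj₀', hjj₀⟩ := Finset.mem_filter.1 hj₀T
  obtain ⟨hj₀s, hlj₀⟩ := Finset.mem_filter.1 hj₀'
  -- every bottom with non-zero coefficient is above `bot j₀` as soon as it is comparable from below: minimality
  have hall : ∀ x ∈ s, l x ≠ 0 → (m x).coeff (bot j₀) ≠ 0 →
      ∀ t : ℕ, (∑ i : Fin n, if (i : ℕ) < t then bot j₀ i else 0) ≤ ∑ i : Fin n, if (i : ℕ) < t then bot x i else 0 := by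
    intro x hx hlx hmx
    have hle : (fun t : Fin (n + 1) => ∑ i : Fin n, if (i : ℕ) < (t : ℕ) then bot x i else 0) ≤
        fun t : Fin (n + 1) => ∑ i : Fin n, if (i : ℕ) < (t : ℕ) then bot j₀ i else 0 := fun t => hsupp x hx _ hmx t
    have hxT : x ∈ T := Finset.mem_filter.2 ⟨Finset.mem_filter.2 ⟨hx, hlx⟩, le_trans hle hjj₀⟩
    exact forall_sum_ite_lt_le_of_pi_le (hmin hxT hle)
  -- the coefficient of `x^{bot j₀}` in `X` is `l_{j₀} · unit ≠ 0`
  have hcoeff : (∑ x ∈ s, l x • m x).coeff (bot j₀) = l j₀ * (m j₀).coeff (bot j₀) := by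
    simp only [AddMonoidAlgebra.coeff_sum, AddMonoidAlgebra.coeff_smul, Finsupp.coe_finsetSum, Finsupp.coe_smul,
      Finset.sum_apply, Pi.smul_apply, smul_eq_mul]
    rw [Finset.sum_eq_single_of_mem j₀ hj₀s]
    intro x hx hne
    by_cases hl0 : l x = 0
    · rw [hl0, zero_mul]
    by_cases hm0 : (m x).coeff (bot j₀) = 0
    · rw [hm0, mul_zero]
    exfalso
    exact hne (hbot hx hj₀s (eq_of_forall_sum_ite_lt_le_le (hsupp x hx _ hm0) (hall x hx hl0 hm0)))
  have hne0 : (∑ x ∈ s, l x • m x).coeff (bot j₀) ≠ 0 := by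
    rw [hcoeff]
    exact fun h => hlj₀ ((hlead j₀ hj₀s).mul_left_eq_zero.1 h)
  -- `a ≤ bot j₀ ≤ bot j`
  exact (hX _ hne0 t).trans (forall_sum_ite_lt_le_of_pi_le hjj₀ t)

/-- **Homogeneous version: the degrees of the bottoms.**  If moreover each `m_j` is homogeneous of degree `|bot j|` and
`X = Σ_j l_j m_j` is homogeneous of degree `d`, every `bot j` with `l_j ≠ 0` has degree `d` (look at the coefficient of `X`
at a dominance-minimal bottom of the wrong degree). [cite: Macdonald1995, Ch. V (2.6)] -/
theorem sum_eq_of_coeff_sum_smul_ne_zero {ι : Type*} (s : Finset ι) (l : ι → R)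
    (m : ι → AddMonoidAlgebra R (Fin n → ℤ)) (bot : ι → Fin n → ℤ) (hbot : Set.InjOn bot s)
    (hsupp : ∀ j ∈ s, ∀ μ, (m j).coeff μ ≠ 0 →
      ∀ t : ℕ, (∑ i : Fin n, if (i : ℕ) < t then bot j i else 0) ≤ ∑ i : Fin n, if (i : ℕ) < t then μ i else 0)
    (hlead : ∀ j ∈ s, IsUnit ((m j).coeff (bot j)))
    (hdeg : ∀ j ∈ s, ∀ μ, (m j).coeff μ ≠ 0 → ∑ i, μ i = ∑ i, bot j i) {d : ℤ}
    (hX : ∀ μ, (∑ j ∈ s, l j • m j).coeff μ ≠ 0 → ∑ i, μ i = d)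
    {j : ι} (hj : j ∈ s) (hlj : l j ≠ 0) : ∑ i, bot j i = d := by
  classical
  by_contra hjd
  -- the indices with non-zero coefficient and wrong degree
  set T := (s.filter fun x => l x ≠ 0).filter fun x => ∑ i, bot x i ≠ d with hT
  have hjT : j ∈ T := Finset.mem_filter.2 ⟨Finset.mem_filter.2 ⟨hj, hlj⟩, hjd⟩
  obtain ⟨j₀, hj₀T, hmin⟩ := T.exists_minimalFor (fun x => fun t : Fin (n + 1) =>
    ∑ i : Fin n, if (i : ℕ) < (t : ℕ) then bot x i else 0) ⟨j, hjT⟩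
  obtain ⟨hj₀', hj₀d⟩ := Finset.mem_filter.1 hj₀T
  obtain ⟨hj₀s, hlj₀⟩ := Finset.mem_filter.1 hj₀'
  have hall : ∀ x ∈ s, l x ≠ 0 → (m x).coeff (bot j₀) ≠ 0 →
      ∀ t : ℕ, (∑ i : Fin n, if (i : ℕ) < t then bot j₀ i else 0) ≤ ∑ i : Fin n, if (i : ℕ) < t then bot x i else 0 := by
    intro x hx hlx hmx
    have hle : (fun t : Fin (n + 1) => ∑ i : Fin n, if (i : ℕ) < (t : ℕ) then bot x i else 0) ≤
        fun t : Fin (n + 1) => ∑ i : Fin n, if (i : ℕ) < (t : ℕ) then bot j₀ i else 0 := fun t => hsupp x hx _ hmx t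
    have hxd : ∑ i, bot x i ≠ d := by
      rw [← hdeg x hx _ hmx]
      exact hj₀d
    have hxT : x ∈ T := Finset.mem_filter.2 ⟨Finset.mem_filter.2 ⟨hx, hlx⟩, hxd⟩
    exact forall_sum_ite_lt_le_of_pi_le (hmin hxT hle)
  have hcoeff : (∑ x ∈ s, l x • m x).coeff (bot j₀) = l j₀ * (m j₀).coeff (bot j₀) := by
    simp only [AddMonoidAlgebra.coeff_sum, AddMonoidAlgebra.coeff_smul, Finsupp.coe_finsetSum, Finsupp.coe_smul,
      Finset.sum_apply, Pi.smul_apply, smul_eq_mul]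
    rw [Finset.sum_eq_single_of_mem j₀ hj₀s]
    intro x hx hne
    by_cases hl0 : l x = 0
    · rw [hl0, zero_mul]
    by_cases hm0 : (m x).coeff (bot j₀) = 0
    · rw [hm0, mul_zero]
    exfalso
    exact hne (hbot hx hj₀s (eq_of_forall_sum_ite_lt_le_le (hsupp x hx _ hm0) (hall x hx hl0 hm0)))
  have hne0 : (∑ x ∈ s, l x • m x).coeff (bot j₀) ≠ 0 := by
    rw [hcoeff]
    exact fun h => hlj₀ ((hlead j₀ hj₀s).mul_left_eq_zero.1 h)
  exact hj₀d (hX _ hne0)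

/-- **The potential `Σ_{s ≤ n} Σ_{i<s} a_i` of a non-negative vector is at most `(n+1)` times its degree.**
[cite: Macdonald1995, Ch. I §1] -/
theorem sum_range_sum_ite_lt_le_of_nonneg {a : Fin n → ℤ} (ha : ∀ i, 0 ≤ a i) :
    (∑ s ∈ Finset.range (n + 1), ∑ i : Fin n, if (i : ℕ) < s then a i else 0) ≤ (n + 1 : ℕ) * ∑ i, a i := by
  have h : ∀ s ∈ Finset.range (n + 1), (∑ i : Fin n, if (i : ℕ) < s then a i else 0) ≤ ∑ i, a i := fun s _ =>
    Finset.sum_le_sum fun i _ => by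
      split_ifs
      · exact le_rfl
      · exact ha i
  calc (∑ s ∈ Finset.range (n + 1), ∑ i : Fin n, if (i : ℕ) < s then a i else 0)
      ≤ ∑ s ∈ Finset.range (n + 1), ∑ i, a i := Finset.sum_le_sum h
    _ = (n + 1 : ℕ) * ∑ i, a i := by rw [Finset.sum_const, Finset.card_range, nsmul_eq_mul]

/-- **Strict dominance raises the potential**: if `a` is dominance-below `b` and `a ≠ b`, then
`Σ_{s ≤ n} HS_s(a) < Σ_{s ≤ n} HS_s(b)`. [cite: Macdonald1995, Ch. I §1] -/
theorem sum_range_sum_ite_lt_lt_of_forall_le_of_ne {a b : Fin n → ℤ}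
    (hle : ∀ t : ℕ, (∑ i : Fin n, if (i : ℕ) < t then a i else 0) ≤ ∑ i : Fin n, if (i : ℕ) < t then b i else 0)
    (hne : a ≠ b) :
    (∑ s ∈ Finset.range (n + 1), ∑ i : Fin n, if (i : ℕ) < s then a i else 0) <
      ∑ s ∈ Finset.range (n + 1), ∑ i : Fin n, if (i : ℕ) < s then b i else 0 := by
  have hex : ∃ s ∈ Finset.range (n + 1), (∑ i : Fin n, if (i : ℕ) < s then a i else 0) <
      ∑ i : Fin n, if (i : ℕ) < s then b i else 0 := by
    by_contra h'
    apply hne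
    refine eq_of_forall_sum_ite_lt_le_le hle fun s => ?_
    by_cases hs : s ≤ n
    · exact not_lt.1 fun hlt => h' ⟨s, Finset.mem_range.2 (Nat.lt_succ_of_le hs), hlt⟩
    · rw [sum_ite_lt_eq_of_le (μ := b) (not_le.1 hs).le, sum_ite_lt_eq_of_le (μ := a) (not_le.1 hs).le]
      exact not_lt.1 fun hlt => h' ⟨n, Finset.mem_range.2 (Nat.lt_succ_self n), hlt⟩
  exact Finset.sum_lt_sum (fun t _ => hle t) hex

end Abstract

/-! ## §2 Degrees and integrality on the Hecke side -/

section Hecke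

variable {F : Type*} [Field F] [ValuativeRel F] {n : ℕ} [IsDiscreteValuationRing 𝒪[F]] {ϖ : F}
  [IsHeckeTriple (⊤ : Submonoid (GL (Fin n) F)) (glInt n F) (glInt n F)] {R : Type*} [CommRing R]

/-- **`𝒮_w(c_a)` is homogeneous of degree `|a|`**: every exponent of the transform of the double-coset operator of
`K ϖ^a K` (any `a ∈ ℤⁿ`) has total `Σ_i a_i` (`|e(g)| = |a|` on `K ϖ^a K`, the valuation of the determinant).
[cite: Macdonald1995, Ch. V (2.6)] -/
theorem sum_eq_sum_of_coeff_satakeTransform_zpowDiagGL_ne_zero (hϖ : IsUniformizingElement ϖ)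
    (w : Multiplicative (Fin n → ℤ) →* R) (a : Fin n → ℤ) {μ : Fin n → ℤ}
    (hμ : ((isIwasawaExponent_gl hϖ).satakeTransform w
      (heckeAlgebra.doubleCosetOperator (glInt n F) (zpowDiagGL hϖ.ne_zero a))).coeff μ ≠ 0) :
    ∑ i, μ i = ∑ i, a i := by
  by_contra hne
  refine hμ ((isIwasawaExponent_gl hϖ).coeff_satakeTransform_doubleCosetOperator_eq_zero w fun γ hγ he => hne ?_)
  have hγ' : (γ.out : GL (Fin n) F ⧸ glInt n F) ∈ orbit (glInt n F) (zpowDiagGL hϖ.ne_zero a : GL (Fin n) F ⧸ glInt n F) := by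
    rwa [QuotientGroup.out_eq']
  rw [← he]
  exact sum_iwasawaExp_eq_of_mem_orbit hϖ hγ'

omit [IsDiscreteValuationRing 𝒪[F]] [IsHeckeTriple (⊤ : Submonoid (GL (Fin n) F)) (glInt n F) (glInt n F)] in
/-- `ϖ^a` with `a ≥ 0` is an integral matrix. [cite: Macdonald1995, Ch. V (2.2)] -/
theorem isIntegralMatrix_zpowDiagGL_of_nonneg (hϖ : IsUniformizingElement ϖ) {a : Fin n → ℤ} (ha : ∀ i, 0 ≤ a i) :
    IsIntegralMatrix ((zpowDiagGL hϖ.ne_zero a : GL (Fin n) F) : Matrix (Fin n) (Fin n) F) := by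
  intro i j
  rw [coe_zpowDiagGL, Matrix.diagonal_apply]
  split_ifs with h
  · rw [← Int.toNat_of_nonneg (ha i), zpow_natCast]
    exact Subring.pow_mem _ hϖ.mem _
  · exact Subring.zero_mem _

omit [IsDiscreteValuationRing 𝒪[F]] in
/-- The double-coset operator only depends on the exponent up to the order-reversing permutation: `c_{ϖ^b} = c_{ϖ^{b ∘ rev}}`.
[cite: Macdonald1995, Ch. V (2.2)] -/
theorem doubleCosetOperator_zpowDiagGL_eq_comp_rev (hϖ0 : ϖ ≠ 0) (b : Fin n → ℤ) :
    heckeAlgebra.doubleCosetOperator (k := R) (glInt n F) (zpowDiagGL hϖ0 b) =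
      heckeAlgebra.doubleCosetOperator (k := R) (glInt n F) (zpowDiagGL hϖ0 (b ∘ Fin.rev)) := by
  obtain ⟨k₁, hk₁, k₂, hk₂, hk⟩ := exists_glInt_mul_zpowDiagGL_mul_eq_of_perm hϖ0 (a := b) (b := b ∘ Fin.rev)
    Fin.revPerm (fun i => by simp only [Function.comp_apply, Fin.revPerm_apply, Fin.rev_rev])
  rw [← hk, heckeAlgebra.doubleCosetOperator_mul_mul_eq (glInt n F) hk₁ hk₂]

/-- **Integral matrices have monotone non-negative Cartan exponents**: for `x` integral, `K x K = K ϖ^b K` with `b ∈ ℤⁿ`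
monotone and `b ≥ 0` (Smith normal form over `𝒪`, `exists_glInt_mul_mul_eq_piPowGL`, followed by the order-reversing
permutation). [cite: Macdonald1995, Ch. V (2.2)–(2.3)] [cite: CartierCorvallis1979, §IV.2] -/
theorem exists_monotone_nonneg_doubleCosetOperator_eq (hϖ : IsUniformizingElement ϖ) {x : GL (Fin n) F}
    (hx : IsIntegralMatrix (x : Matrix (Fin n) (Fin n) F)) :
    ∃ b : Fin n → ℤ, Monotone b ∧ (∀ i, 0 ≤ b i) ∧ heckeAlgebra.doubleCosetOperator (k := R) (glInt n F) x =
      heckeAlgebra.doubleCosetOperator (k := R) (glInt n F) (zpowDiagGL hϖ.ne_zero b) := by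
  obtain ⟨k₁, hk₁, k₂, hk₂, a, ha, h⟩ := exists_glInt_mul_mul_eq_piPowGL hϖ hx
  refine ⟨fun i => (a (Fin.rev i) : ℤ), fun i j hij => ?_, fun i => Int.natCast_nonneg _, ?_⟩
  · dsimp only
    exact_mod_cast ha (Fin.rev_le_rev.2 hij)
  · rw [← heckeAlgebra.doubleCosetOperator_mul_mul_eq (k := R) (glInt n F) hk₁ hk₂, h, ← zpowDiagGL_natCast,
      doubleCosetOperator_zpowDiagGL_eq_comp_rev]
    rfl

/-- The `R`-span of the integral double cosets is spanned by the `c_{ϖ^b}`, `b` monotone `≥ 0`.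
[cite: Macdonald1995, Ch. V (2.3)] -/
theorem span_doubleCosetOperator_isIntegralMatrix_le_span_image (hϖ : IsUniformizingElement ϖ) :
    Submodule.span R (heckeAlgebra.doubleCosetOperator (k := R) (glInt n F) ''
        {x : GL (Fin n) F | IsIntegralMatrix (x : Matrix (Fin n) (Fin n) F)}) ≤
      Submodule.span R ((fun b : Fin n → ℤ => heckeAlgebra.doubleCosetOperator (k := R) (glInt n F)
        (zpowDiagGL hϖ.ne_zero b)) '' {b : Fin n → ℤ | Monotone b ∧ ∀ i, 0 ≤ b i}) := by
  refine Submodule.span_le.2 ?_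
  rintro _ ⟨x, hx, rfl⟩
  obtain ⟨b, hb, hb0, hxb⟩ := exists_monotone_nonneg_doubleCosetOperator_eq (R := R) hϖ hx
  rw [hxb]
  exact Submodule.subset_span ⟨b, ⟨hb, hb0⟩, rfl⟩

omit [IsDiscreteValuationRing 𝒪[F]] in
/-- The `R`-span of the integral double cosets is closed under multiplication (`HeckeRingOfSubmonoid` for the semigroup of
integral matrices). [cite: Macdonald1995, Ch. V (2.3)] [cite: ShimuraIATAF1971, §3.1] -/
theorem mul_mem_span_doubleCosetOperator_isIntegralMatrix {S T : heckeAlgebra R (GL (Fin n) F) (glInt n F)}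
    (hS : S ∈ Submodule.span R (heckeAlgebra.doubleCosetOperator (k := R) (glInt n F) ''
      {x : GL (Fin n) F | IsIntegralMatrix (x : Matrix (Fin n) (Fin n) F)}))
    (hT : T ∈ Submodule.span R (heckeAlgebra.doubleCosetOperator (k := R) (glInt n F) ''
      {x : GL (Fin n) F | IsIntegralMatrix (x : Matrix (Fin n) (Fin n) F)})) :
    S * T ∈ Submodule.span R (heckeAlgebra.doubleCosetOperator (k := R) (glInt n F) ''
      {x : GL (Fin n) F | IsIntegralMatrix (x : Matrix (Fin n) (Fin n) F)}) :=
  heckeAlgebra.mul_mem_span_doubleCosetOperator (glInt n F)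
    (Δ := {x : GL (Fin n) F | IsIntegralMatrix (x : Matrix (Fin n) (Fin n) F)})
    (fun a ha b hb => by
      simp only [Set.mem_setOf_eq, Units.val_mul] at ha hb ⊢
      exact ha.mul hb)
    (fun κ hκ => isIntegralMatrix_of_mem_glInt hκ) hS hT

omit [IsDiscreteValuationRing 𝒪[F]] [IsHeckeTriple (⊤ : Submonoid (GL (Fin n) F)) (glInt n F) (glInt n F)] in
/-- The exponent `(0^{n-r-1}, 1^{r+1})` is non-negative. [cite: Macdonald1995, Ch. V (2.2)] -/
theorem indicator_rev_le_nonneg (r i : Fin n) : (0 : ℤ) ≤ if ((Fin.rev i : Fin n) : ℕ) ≤ (r : ℕ) then (1 : ℤ) else 0 := by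
  split_ifs <;> omega

/-! ## §3 Every integral Cartan double coset lies in `R[c_{(1)}, …, c_{(1ⁿ)}]` -/

/-- **MAIN THEOREM (Macdonald (2.3)+(2.7), Tamagawa, INTEGRALLY): for `a ∈ ℤⁿ` monotone with `a ≥ 0`, the double-coset
operator `c_a` of `K ϖ^a K` lies in the subalgebra `R[c_{(1)}, …, c_{(1ⁿ)}]` of `ℋ(GL_n(F), GL_n(𝒪_F); R)`**, for EVERY
commutative ring `R`, every `F` whose valuation ring is a DVR and every uniformizer (double induction on the degree and
the potential; bottom terms of the counting Satake transform, Bruhat–Tits (4.4.4) (ii)).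
[cite: Macdonald1995, Ch. V (2.3), (2.6)–(2.7)] [cite: CartierCorvallis1979, §IV, proof of Thm. 4.1 (c)]
[cite: BruhatTits1972, Prop. (4.4.4)] -/
theorem doubleCosetOperator_zpowDiagGL_mem_adjoin_of_monotone_of_nonneg (hϖ : IsUniformizingElement ϖ)
    {a : Fin n → ℤ} (ha : Monotone a) (ha0 : ∀ i, 0 ≤ a i) :
    heckeAlgebra.doubleCosetOperator (k := R) (glInt n F) (zpowDiagGL hϖ.ne_zero a) ∈
      Algebra.adjoin R (Set.range fun r : Fin n => heckeAlgebra.doubleCosetOperator (k := R) (glInt n F)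
        (zpowDiagGL hϖ.ne_zero fun i : Fin n => if (i : ℕ) ≤ (r : ℕ) then (1 : ℤ) else 0)) := by
  classical
  -- double induction: on the degree `d = |a|`, then on `N ≥ (n+1) d - potential(a)`
  suffices h : ∀ (d N : ℕ) (a : Fin n → ℤ), Monotone a → (∀ i, 0 ≤ a i) → ∑ i, a i = d →
      ((n + 1 : ℕ) * (d : ℤ) - ∑ s ∈ Finset.range (n + 1), ∑ i : Fin n, if (i : ℕ) < s then a i else 0) ≤ N →
      heckeAlgebra.doubleCosetOperator (k := R) (glInt n F) (zpowDiagGL hϖ.ne_zero a) ∈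
        Algebra.adjoin R (Set.range fun r : Fin n => heckeAlgebra.doubleCosetOperator (k := R) (glInt n F)
          (zpowDiagGL hϖ.ne_zero fun i : Fin n => if (i : ℕ) ≤ (r : ℕ) then (1 : ℤ) else 0)) by
    have hd : 0 ≤ ∑ i, a i := Finset.sum_nonneg fun i _ => ha0 i
    refine h (∑ i, a i).toNat _ a ha ha0 (Int.toNat_of_nonneg hd).symm (Int.self_le_toNat _)
  intro d
  induction d using Nat.strong_induction_on with
  | _ d ihd =>
  intro N
  induction N using Nat.strong_induction_on with
  | _ N ihN =>
  intro a ha ha0 hdeg hN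
  -- the generators and the subalgebra
  set A := Algebra.adjoin R (Set.range fun r : Fin n => heckeAlgebra.doubleCosetOperator (k := R) (glInt n F)
    (zpowDiagGL hϖ.ne_zero fun i : Fin n => if (i : ℕ) ≤ (r : ℕ) then (1 : ℤ) else 0)) with hA
  by_cases h0 : ∀ i, a i = 0
  · have h0' : a = (0 : Fin n → ℤ) := funext h0
    rw [h0', zpowDiagGL_zero, heckeAlgebra.doubleCosetOperator_one]
    exact Subalgebra.one_mem _
  -- `i₀` = the first index with `a_{i₀} > 0`
  have hne : (Finset.univ.filter fun i : Fin n => 0 < a i).Nonempty := by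
    obtain ⟨i, hi⟩ := not_forall.1 h0
    exact ⟨i, Finset.mem_filter.2 ⟨Finset.mem_univ _, lt_of_le_of_ne (ha0 i) (Ne.symm hi)⟩⟩
  set i₀ := (Finset.univ.filter fun i : Fin n => 0 < a i).min' hne with hi₀
  have hi₀pos : 0 < a i₀ := (Finset.mem_filter.1 (Finset.min'_mem _ hne)).2
  have hlt : ∀ i : Fin n, i < i₀ → a i = 0 := by
    intro i hi
    by_contra h
    have := Finset.min'_le (Finset.univ.filter fun i : Fin n => 0 < a i) i
      (Finset.mem_filter.2 ⟨Finset.mem_univ _, lt_of_le_of_ne (ha0 i) (Ne.symm h)⟩)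
    rw [← hi₀] at this
    exact absurd hi (not_lt.2 this)
  have hge : ∀ i : Fin n, i₀ ≤ i → 1 ≤ a i := fun i hi => le_trans (by omega) (ha hi)
  -- the generator `c_r`, `r = rev i₀`, with monotone exponent `ε = (0^{i₀}, 1^{n - i₀})`
  set r : Fin n := Fin.rev i₀ with hr
  set ε : Fin n → ℤ := fun i : Fin n => if ((Fin.rev i : Fin n) : ℕ) ≤ (r : ℕ) then (1 : ℤ) else 0 with hε
  have hεi : ∀ i : Fin n, ε i = if i₀ ≤ i then 1 else 0 := by
    intro i
    simp only [hε, hr]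
    have : ((Fin.rev i : Fin n) : ℕ) ≤ ((Fin.rev i₀ : Fin n) : ℕ) ↔ i₀ ≤ i := by
      rw [Fin.val_rev, Fin.val_rev, Fin.le_def]
      have := i.isLt
      have := i₀.isLt
      omega
    simp only [this]
  -- `a' = a - ε`
  set a' : Fin n → ℤ := fun i => a i - ε i with ha'def
  have ha' : Monotone a' := by
    intro i j hij
    simp only [ha'def, hεi]
    have hmono := ha hij
    by_cases h1 : i₀ ≤ i
    · rw [if_pos h1, if_pos (le_trans h1 hij)]
      omega
    · rw [if_neg h1]
      have hi0 : a i = 0 := hlt i (not_le.1 h1)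
      by_cases h2 : i₀ ≤ j
      · rw [if_pos h2]
        have := hge j h2
        omega
      · rw [if_neg h2]
        omega
  have ha'0 : ∀ i, 0 ≤ a' i := by
    intro i
    simp only [ha'def, hεi]
    by_cases h1 : i₀ ≤ i
    · rw [if_pos h1]
      have := hge i h1
      omega
    · rw [if_neg h1]
      have := ha0 i
      omega
  have hsum : a = a' + ε := funext fun i => by simp only [Pi.add_apply, ha'def]; ring
  -- the degree of `a'` is smaller
  have hεdeg : 1 ≤ ∑ i, ε i := by
    have h1 : ε i₀ = 1 := by rw [hεi, if_pos le_rfl]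
    rw [← h1]
    exact Finset.single_le_sum (fun i _ => by rw [hεi]; split_ifs <;> omega) (Finset.mem_univ i₀)
  have hdeg' : ∑ i, a' i = d - ∑ i, ε i := by
    rw [← hdeg, hsum]
    simp only [Pi.add_apply, Finset.sum_add_distrib]
    ring
  have hd'nonneg : 0 ≤ ∑ i, a' i := Finset.sum_nonneg fun i _ => ha'0 i
  have hca' : heckeAlgebra.doubleCosetOperator (k := R) (glInt n F) (zpowDiagGL hϖ.ne_zero a') ∈ A := by
    refine ihd (∑ i, a' i).toNat (by omega) _ a' ha' ha'0 (Int.toNat_of_nonneg hd'nonneg).symm (Int.self_le_toNat _)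
  -- `P = c_{a'} c_r ∈ A`
  have hcr : heckeAlgebra.doubleCosetOperator (k := R) (glInt n F)
      (zpowDiagGL hϖ.ne_zero fun i : Fin n => if (i : ℕ) ≤ (r : ℕ) then (1 : ℤ) else 0) ∈ A :=
    Algebra.subset_adjoin (Set.mem_range_self r)
  have hP := Subalgebra.mul_mem _ hca' hcr
  -- the counting transforms: bottoms `a` (for `c_a`) and `a' + ε = a` (for `P`), bottom coefficients `1`
  set S := (isIwasawaExponent_gl hϖ).satakeTransform (1 : Multiplicative (Fin n → ℤ) →* R) with hS
  have hcr' : heckeAlgebra.doubleCosetOperator (k := R) (glInt n F)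
      (zpowDiagGL hϖ.ne_zero fun i : Fin n => if (i : ℕ) ≤ (r : ℕ) then (1 : ℤ) else 0) =
      heckeAlgebra.doubleCosetOperator (k := R) (glInt n F) (zpowDiagGL hϖ.ne_zero ε) :=
    doubleCosetOperator_zpowDiagGL_indicator_le_eq_rev hϖ.ne_zero r
  have hεmono : Monotone ε := monotone_indicator_rev_le r
  have htriA := fun μ (hμ : (S (heckeAlgebra.doubleCosetOperator (k := R) (glInt n F)
      (zpowDiagGL hϖ.ne_zero a))).coeff μ ≠ 0) t =>
    forall_sum_ite_lt_le_of_coeff_satakeTransform_zpowDiagGL_ne_zero hϖ 1 ha hμ t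
  have htriA' := fun μ (hμ : (S (heckeAlgebra.doubleCosetOperator (k := R) (glInt n F)
      (zpowDiagGL hϖ.ne_zero a'))).coeff μ ≠ 0) t =>
    forall_sum_ite_lt_le_of_coeff_satakeTransform_zpowDiagGL_ne_zero hϖ 1 ha' hμ t
  have htriE := fun μ (hμ : (S (heckeAlgebra.doubleCosetOperator (k := R) (glInt n F)
      (zpowDiagGL hϖ.ne_zero ε))).coeff μ ≠ 0) t =>
    forall_sum_ite_lt_le_of_coeff_satakeTransform_zpowDiagGL_ne_zero hϖ 1 hεmono hμ t
  have hleadA : (S (heckeAlgebra.doubleCosetOperator (k := R) (glInt n F) (zpowDiagGL hϖ.ne_zero a))).coeff a = 1 :=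
    coeff_satakeTransform_one_doubleCosetOperator_zpowDiagGL_monotone hϖ ha
  have hleadA' : (S (heckeAlgebra.doubleCosetOperator (k := R) (glInt n F) (zpowDiagGL hϖ.ne_zero a'))).coeff a' = 1 :=
    coeff_satakeTransform_one_doubleCosetOperator_zpowDiagGL_monotone hϖ ha'
  have hleadE : (S (heckeAlgebra.doubleCosetOperator (k := R) (glInt n F) (zpowDiagGL hϖ.ne_zero ε))).coeff ε = 1 :=
    coeff_satakeTransform_one_doubleCosetOperator_zpowDiagGL_monotone hϖ hεmono
  have hSP : S (heckeAlgebra.doubleCosetOperator (k := R) (glInt n F) (zpowDiagGL hϖ.ne_zero a') *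
      heckeAlgebra.doubleCosetOperator (k := R) (glInt n F)
        (zpowDiagGL hϖ.ne_zero fun i : Fin n => if (i : ℕ) ≤ (r : ℕ) then (1 : ℤ) else 0)) =
      S (heckeAlgebra.doubleCosetOperator (k := R) (glInt n F) (zpowDiagGL hϖ.ne_zero a')) *
        S (heckeAlgebra.doubleCosetOperator (k := R) (glInt n F) (zpowDiagGL hϖ.ne_zero ε)) := by
    rw [map_mul, hcr']
  have htriP : ∀ μ, (S (heckeAlgebra.doubleCosetOperator (k := R) (glInt n F) (zpowDiagGL hϖ.ne_zero a') *
      heckeAlgebra.doubleCosetOperator (k := R) (glInt n F)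
        (zpowDiagGL hϖ.ne_zero fun i : Fin n => if (i : ℕ) ≤ (r : ℕ) then (1 : ℤ) else 0))).coeff μ ≠ 0 →
      ∀ t : ℕ, (∑ i : Fin n, if (i : ℕ) < t then a i else 0) ≤ ∑ i : Fin n, if (i : ℕ) < t then μ i else 0 := by
    intro μ hμ t
    rw [hSP] at hμ
    have := forall_sum_ite_lt_le_of_coeff_mul_ne_zero htriA' htriE hμ t
    rw [← hsum] at this
    exact this
  have hleadP : (S (heckeAlgebra.doubleCosetOperator (k := R) (glInt n F) (zpowDiagGL hϖ.ne_zero a') *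
      heckeAlgebra.doubleCosetOperator (k := R) (glInt n F)
        (zpowDiagGL hϖ.ne_zero fun i : Fin n => if (i : ℕ) ≤ (r : ℕ) then (1 : ℤ) else 0))).coeff a = 1 := by
    rw [hSP, hsum, coeff_mul_add_eq_mul_coeff_of_forall_sum_ite_lt_le htriA' htriE, hleadA', hleadE, mul_one]
  -- degrees: both transforms are homogeneous of degree `d`
  have hdegA := fun μ (hμ : (S (heckeAlgebra.doubleCosetOperator (k := R) (glInt n F)
      (zpowDiagGL hϖ.ne_zero a))).coeff μ ≠ 0) =>
    (sum_eq_sum_of_coeff_satakeTransform_zpowDiagGL_ne_zero hϖ 1 a hμ).trans hdeg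
  have hdegP : ∀ μ, (S (heckeAlgebra.doubleCosetOperator (k := R) (glInt n F) (zpowDiagGL hϖ.ne_zero a') *
      heckeAlgebra.doubleCosetOperator (k := R) (glInt n F)
        (zpowDiagGL hϖ.ne_zero fun i : Fin n => if (i : ℕ) ≤ (r : ℕ) then (1 : ℤ) else 0))).coeff μ ≠ 0 →
      ∑ i, μ i = d := by
    intro μ hμ
    rw [hSP] at hμ
    rw [sum_eq_add_of_coeff_mul_ne_zero (fun ν hν => sum_eq_sum_of_coeff_satakeTransform_zpowDiagGL_ne_zero hϖ 1 a' hν)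
      (fun ν hν => sum_eq_sum_of_coeff_satakeTransform_zpowDiagGL_ne_zero hϖ 1 ε hν) hμ, hdeg', sub_add_cancel]
  -- `D = c_a + (-1) • P` (no subtraction inside `ℋ`)
  set D := heckeAlgebra.doubleCosetOperator (k := R) (glInt n F) (zpowDiagGL hϖ.ne_zero a) +
    (-1 : R) • (heckeAlgebra.doubleCosetOperator (k := R) (glInt n F) (zpowDiagGL hϖ.ne_zero a') *
      heckeAlgebra.doubleCosetOperator (k := R) (glInt n F)
        (zpowDiagGL hϖ.ne_zero fun i : Fin n => if (i : ℕ) ≤ (r : ℕ) then (1 : ℤ) else 0)) with hD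
  -- `D` is an `R`-combination of integral Cartan double cosets `c_b`, `b` monotone `≥ 0`
  have hmem_int : ∀ b : Fin n → ℤ, (∀ i, 0 ≤ b i) → heckeAlgebra.doubleCosetOperator (k := R) (glInt n F)
      (zpowDiagGL hϖ.ne_zero b) ∈ Submodule.span R (heckeAlgebra.doubleCosetOperator (k := R) (glInt n F) ''
        {x : GL (Fin n) F | IsIntegralMatrix (x : Matrix (Fin n) (Fin n) F)}) := fun b hb =>
    Submodule.subset_span ⟨zpowDiagGL hϖ.ne_zero b, isIntegralMatrix_zpowDiagGL_of_nonneg hϖ hb, rfl⟩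
  have hcr_int : heckeAlgebra.doubleCosetOperator (k := R) (glInt n F)
      (zpowDiagGL hϖ.ne_zero fun i : Fin n => if (i : ℕ) ≤ (r : ℕ) then (1 : ℤ) else 0) ∈
      Submodule.span R (heckeAlgebra.doubleCosetOperator (k := R) (glInt n F) ''
        {x : GL (Fin n) F | IsIntegralMatrix (x : Matrix (Fin n) (Fin n) F)}) := by
    rw [hcr']
    exact hmem_int ε (indicator_rev_le_nonneg r)
  have hDint : D ∈ Submodule.span R (heckeAlgebra.doubleCosetOperator (k := R) (glInt n F) ''
      {x : GL (Fin n) F | IsIntegralMatrix (x : Matrix (Fin n) (Fin n) F)}) := by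
    rw [hD]
    exact Submodule.add_mem _ (hmem_int a ha0)
      (Submodule.smul_mem _ _ (mul_mem_span_doubleCosetOperator_isIntegralMatrix (hmem_int a' ha'0) hcr_int))
  obtain ⟨l, hl, hlD⟩ := (Finsupp.mem_span_image_iff_linearCombination R).1
    (span_doubleCosetOperator_isIntegralMatrix_le_span_image (R := R) hϖ hDint)
  rw [Finsupp.linearCombination_apply, Finsupp.sum] at hlD
  -- `𝒮(D) = Σ_b l_b 𝒮(c_b)`
  have hSD : (∑ b ∈ l.support, l b • S (heckeAlgebra.doubleCosetOperator (k := R) (glInt n F)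
      (zpowDiagGL hϖ.ne_zero b))) = S D := by
    have h1 : S.toLinearMap D = ∑ b ∈ l.support, S.toLinearMap
        (l b • heckeAlgebra.doubleCosetOperator (k := R) (glInt n F) (zpowDiagGL hϖ.ne_zero b)) := by
      rw [← hlD, map_sum]
    rw [AlgHom.toLinearMap_apply] at h1
    rw [h1]
    exact Finset.sum_congr rfl fun b _ => by rw [map_smul, AlgHom.toLinearMap_apply]
  have hSD' : S D = S (heckeAlgebra.doubleCosetOperator (k := R) (glInt n F) (zpowDiagGL hϖ.ne_zero a)) +
      (-1 : R) • S (heckeAlgebra.doubleCosetOperator (k := R) (glInt n F) (zpowDiagGL hϖ.ne_zero a') *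
        heckeAlgebra.doubleCosetOperator (k := R) (glInt n F)
          (zpowDiagGL hϖ.ne_zero fun i : Fin n => if (i : ℕ) ≤ (r : ℕ) then (1 : ℤ) else 0)) := by
    rw [hD, ← AlgHom.toLinearMap_apply, map_add, map_smul, AlgHom.toLinearMap_apply, AlgHom.toLinearMap_apply]
  -- the exponents of `𝒮(D)`: above `a`, of degree `d`; and the coefficient of `x^a` vanishes
  have hXtri : ∀ μ, (∑ b ∈ l.support, l b • S (heckeAlgebra.doubleCosetOperator (k := R) (glInt n F)
      (zpowDiagGL hϖ.ne_zero b))).coeff μ ≠ 0 →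
      ∀ t : ℕ, (∑ i : Fin n, if (i : ℕ) < t then a i else 0) ≤ ∑ i : Fin n, if (i : ℕ) < t then μ i else 0 := by
    intro μ hμ t
    rw [hSD, hSD', AddMonoidAlgebra.coeff_add, AddMonoidAlgebra.coeff_smul, Finsupp.add_apply, Finsupp.smul_apply,
      smul_eq_mul] at hμ
    by_cases h1 : (S (heckeAlgebra.doubleCosetOperator (k := R) (glInt n F) (zpowDiagGL hϖ.ne_zero a))).coeff μ = 0
    · rw [h1, zero_add] at hμ
      exact htriP μ (right_ne_zero_of_mul hμ) t
    · exact htriA μ h1 t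
  have hXdeg : ∀ μ, (∑ b ∈ l.support, l b • S (heckeAlgebra.doubleCosetOperator (k := R) (glInt n F)
      (zpowDiagGL hϖ.ne_zero b))).coeff μ ≠ 0 → ∑ i, μ i = d := by
    intro μ hμ
    rw [hSD, hSD', AddMonoidAlgebra.coeff_add, AddMonoidAlgebra.coeff_smul, Finsupp.add_apply, Finsupp.smul_apply,
      smul_eq_mul] at hμ
    by_cases h1 : (S (heckeAlgebra.doubleCosetOperator (k := R) (glInt n F) (zpowDiagGL hϖ.ne_zero a))).coeff μ = 0
    · rw [h1, zero_add] at hμ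
      exact hdegP μ (right_ne_zero_of_mul hμ)
    · exact hdegA μ h1
  have hXa : (∑ b ∈ l.support, l b • S (heckeAlgebra.doubleCosetOperator (k := R) (glInt n F)
      (zpowDiagGL hϖ.ne_zero b))).coeff a = 0 := by
    rw [hSD, hSD', AddMonoidAlgebra.coeff_add, AddMonoidAlgebra.coeff_smul, Finsupp.add_apply, Finsupp.smul_apply,
      smul_eq_mul, hleadA, hleadP]
    ring
  -- hypotheses of the abstract support lemmas for the family `b ↦ 𝒮(c_b)` on `l.support`
  have hmono_of : ∀ b ∈ l.support, Monotone b ∧ ∀ i, 0 ≤ b i := fun b hb => hl (Finset.mem_coe.2 hb)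
  have hsupp : ∀ b ∈ l.support, ∀ μ, (S (heckeAlgebra.doubleCosetOperator (k := R) (glInt n F)
      (zpowDiagGL hϖ.ne_zero b))).coeff μ ≠ 0 →
      ∀ t : ℕ, (∑ i : Fin n, if (i : ℕ) < t then b i else 0) ≤ ∑ i : Fin n, if (i : ℕ) < t then μ i else 0 :=
    fun b hb μ hμ t => forall_sum_ite_lt_le_of_coeff_satakeTransform_zpowDiagGL_ne_zero hϖ 1 (hmono_of b hb).1 hμ t
  have hlead : ∀ b ∈ l.support, IsUnit ((S (heckeAlgebra.doubleCosetOperator (k := R) (glInt n F)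
      (zpowDiagGL hϖ.ne_zero b))).coeff b) := fun b hb => by
    rw [coeff_satakeTransform_one_doubleCosetOperator_zpowDiagGL_monotone hϖ (hmono_of b hb).1]
    exact isUnit_one
  have hdegb : ∀ b ∈ l.support, ∀ μ, (S (heckeAlgebra.doubleCosetOperator (k := R) (glInt n F)
      (zpowDiagGL hϖ.ne_zero b))).coeff μ ≠ 0 → ∑ i, μ i = ∑ i, b i :=
    fun b _ μ hμ => sum_eq_sum_of_coeff_satakeTransform_zpowDiagGL_ne_zero hϖ 1 b hμ
  have hinj : Set.InjOn (fun b : Fin n → ℤ => b) ↑l.support := fun _ _ _ _ h => h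
  -- every `b` with `l_b ≠ 0` is above `a`, of degree `d`, and different from `a`
  have habove : ∀ b ∈ l.support, ∀ t : ℕ,
      (∑ i : Fin n, if (i : ℕ) < t then a i else 0) ≤ ∑ i : Fin n, if (i : ℕ) < t then b i else 0 := fun b hb t =>
    forall_sum_ite_lt_le_of_coeff_sum_smul_ne_zero l.support (fun b => l b)
      (fun b => S (heckeAlgebra.doubleCosetOperator (k := R) (glInt n F) (zpowDiagGL hϖ.ne_zero b)))
      (fun b => b) hinj hsupp hlead a hXtri hb (Finsupp.mem_support_iff.1 hb) t
  have hdegb' : ∀ b ∈ l.support, ∑ i, b i = d := fun b hb =>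
    sum_eq_of_coeff_sum_smul_ne_zero l.support (fun b => l b)
      (fun b => S (heckeAlgebra.doubleCosetOperator (k := R) (glInt n F) (zpowDiagGL hϖ.ne_zero b)))
      (fun b => b) hinj hsupp hlead hdegb hXdeg hb (Finsupp.mem_support_iff.1 hb)
  have hane : a ∉ l.support := by
    intro haS
    have hc := coeff_sum_smul_eq_mul_of_forall_le l.support (fun b => l b)
      (fun b => S (heckeAlgebra.doubleCosetOperator (k := R) (glInt n F) (zpowDiagGL hϖ.ne_zero b)))
      (fun b => b) hinj hsupp haS (fun b hb _ t => habove b hb t)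
    rw [hXa, hleadA, mul_one] at hc
    exact (Finsupp.mem_support_iff.1 haS) hc.symm
  -- hence `c_b ∈ A` for every `b` in the expansion, by the inner induction
  have hDmem : D ∈ A := by
    rw [← hlD]
    refine Subalgebra.sum_mem _ fun b hb => Subalgebra.smul_mem _ ?_ _
    obtain ⟨hbmono, hb0⟩ := hmono_of b hb
    have hba : b ≠ a := fun h => hane (h ▸ hb)
    have hpot := sum_range_sum_ite_lt_lt_of_forall_le_of_ne (habove b hb) (Ne.symm hba)
    have hpotb := sum_range_sum_ite_lt_le_of_nonneg hb0
    rw [hdegb' b hb] at hpotb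
    -- the measure of `b` is a natural number `< N`
    have hNpos : ((n + 1 : ℕ) * (d : ℤ) - ∑ s ∈ Finset.range (n + 1), ∑ i : Fin n, if (i : ℕ) < s then b i else 0) < N := by
      omega
    have hmeas : 0 ≤ (n + 1 : ℕ) * (d : ℤ) - ∑ s ∈ Finset.range (n + 1), ∑ i : Fin n, if (i : ℕ) < s then b i else 0 := by
      omega
    refine ihN ((n + 1 : ℕ) * (d : ℤ) - ∑ s ∈ Finset.range (n + 1), ∑ i : Fin n, if (i : ℕ) < s then b i else 0).toNat
      (by omega) b hbmono hb0 (hdegb' b hb) (Int.self_le_toNat _)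
  -- conclusion: `c_a = D + P`
  have hca : heckeAlgebra.doubleCosetOperator (k := R) (glInt n F) (zpowDiagGL hϖ.ne_zero a) =
      D + (1 : R) • (heckeAlgebra.doubleCosetOperator (k := R) (glInt n F) (zpowDiagGL hϖ.ne_zero a') *
        heckeAlgebra.doubleCosetOperator (k := R) (glInt n F)
          (zpowDiagGL hϖ.ne_zero fun i : Fin n => if (i : ℕ) ≤ (r : ℕ) then (1 : ℤ) else 0)) := by
    rw [hD, add_assoc, ← add_smul, neg_add_cancel, zero_smul, add_zero]
  rw [hca]
  exact Subalgebra.add_mem _ hDmem (Subalgebra.smul_mem _ hP _)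

/-- **Every integral double coset lies in `R[c_{(1)}, …, c_{(1ⁿ)}]`**: for `x ∈ GL_n(F) ∩ M_n(𝒪_F)`, the operator of
`K x K` is a polynomial in the elementary operators with coefficients in `R`.
[cite: Macdonald1995, Ch. V (2.3), (2.7)] [cite: ShimuraIATAF1971, Thm. 3.20] -/
theorem doubleCosetOperator_mem_adjoin_of_isIntegralMatrix (hϖ : IsUniformizingElement ϖ) {x : GL (Fin n) F}
    (hx : IsIntegralMatrix (x : Matrix (Fin n) (Fin n) F)) :
    heckeAlgebra.doubleCosetOperator (k := R) (glInt n F) x ∈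
      Algebra.adjoin R (Set.range fun r : Fin n => heckeAlgebra.doubleCosetOperator (k := R) (glInt n F)
        (zpowDiagGL hϖ.ne_zero fun i : Fin n => if (i : ℕ) ≤ (r : ℕ) then (1 : ℤ) else 0)) := by
  obtain ⟨b, hb, hb0, hxb⟩ := exists_monotone_nonneg_doubleCosetOperator_eq (R := R) hϖ hx
  rw [hxb]
  exact doubleCosetOperator_zpowDiagGL_mem_adjoin_of_monotone_of_nonneg hϖ hb hb0

/-! ## §4 `span_R {K x K : x integral} = R[c_{(1^r)}]` and `ℋ = R[c_{(1^r)}, c_{ϖ⁻¹ 1_n}]` (Macdonald (2.3), (2.5), (2.7)) -/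

omit [ValuativeRel F] [IsDiscreteValuationRing 𝒪[F]] [IsHeckeTriple (⊤ : Submonoid (GL (Fin n) F)) (glInt n F) (glInt n F)] in
/-- The exponent `(1^{r+1}, 0^{n-r-1})` is non-negative. [cite: Macdonald1995, Ch. V (2.2)] -/
theorem indicator_le_nonneg (r i : Fin n) : (0 : ℤ) ≤ if (i : ℕ) ≤ (r : ℕ) then (1 : ℤ) else 0 := by
  split_ifs <;> omega

/-- **MACDONALD Ch. V (2.3)+(2.7) INTEGRALLY: the integral part `span_R {K x K : x ∈ GL_n(F) ∩ M_n(𝒪_F)}` of the spherical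
Hecke algebra of `GL_n(F)` with coefficients in ANY commutative ring `R` is the polynomial subalgebra
`R[c_{(1)}, …, c_{(1ⁿ)}]`** (as `R`-submodules of `ℋ(GL_n(F), GL_n(𝒪_F); R)`; with g42-#2 the `c_{(1^r)}` are algebraically
independent, so this is «`H(G⁺, K) ⊗ R = R[c_{(1^r)}]`», Tamagawa's theorem; the tree's
`span_doubleCosetOperator_glInt_isIntegralMatrix_eq_toSubmodule_adjoin` is the case `R = ℂ`).
[cite: Macdonald1995, Ch. V (2.3), (2.6)–(2.7)] [cite: ShimuraIATAF1971, Thm. 3.20] -/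
theorem span_doubleCosetOperator_glInt_isIntegralMatrix_eq_toSubmodule_adjoin_of_commRing (hϖ : IsUniformizingElement ϖ) :
    Submodule.span R (heckeAlgebra.doubleCosetOperator (k := R) (glInt n F) ''
        {x : GL (Fin n) F | IsIntegralMatrix (x : Matrix (Fin n) (Fin n) F)}) =
      Subalgebra.toSubmodule (Algebra.adjoin R (Set.range fun r : Fin n => heckeAlgebra.doubleCosetOperator (k := R) (glInt n F)
        (zpowDiagGL hϖ.ne_zero fun i : Fin n => if (i : ℕ) ≤ (r : ℕ) then (1 : ℤ) else 0))) := by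
  apply le_antisymm
  · rw [Submodule.span_le]
    rintro _ ⟨x, hx, rfl⟩
    rw [SetLike.mem_coe, Subalgebra.mem_toSubmodule]
    exact doubleCosetOperator_mem_adjoin_of_isIntegralMatrix hϖ hx
  · intro x hx
    rw [Subalgebra.mem_toSubmodule] at hx
    have hx' : x ∈ Algebra.adjoin R (heckeAlgebra.doubleCosetOperator (k := R) (glInt n F) ''
        {x : GL (Fin n) F | IsIntegralMatrix (x : Matrix (Fin n) (Fin n) F)}) := by
      refine Algebra.adjoin_le ?_ hx
      rintro _ ⟨r, rfl⟩
      exact Algebra.subset_adjoin ⟨_, isIntegralMatrix_zpowDiagGL_of_nonneg hϖ (indicator_le_nonneg r), rfl⟩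
    rw [← Subalgebra.mem_toSubmodule, heckeAlgebra.adjoin_doubleCosetOperator_image_eq_span (glInt n F)
      (Δ := {x : GL (Fin n) F | IsIntegralMatrix (x : Matrix (Fin n) (Fin n) F)})
      (fun a ha b hb => by
        simp only [Set.mem_setOf_eq, Units.val_mul] at ha hb ⊢
        exact ha.mul hb)
      (fun κ hκ => isIntegralMatrix_of_mem_glInt hκ)] at hx'
    exact hx'

/-- **… as subalgebras: `R[c_{(1)}, …, c_{(1ⁿ)}] = R[K x K : x ∈ M_n(𝒪_F)]`.** [cite: Macdonald1995, Ch. V (2.3), (2.7)] -/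
theorem adjoin_glInt_zpowDiagGL_eq_adjoin_isIntegralMatrix_of_commRing (hϖ : IsUniformizingElement ϖ) :
    Algebra.adjoin R (Set.range fun r : Fin n => heckeAlgebra.doubleCosetOperator (k := R) (glInt n F)
        (zpowDiagGL hϖ.ne_zero fun i : Fin n => if (i : ℕ) ≤ (r : ℕ) then (1 : ℤ) else 0)) =
      Algebra.adjoin R (heckeAlgebra.doubleCosetOperator (k := R) (glInt n F) ''
        {x : GL (Fin n) F | IsIntegralMatrix (x : Matrix (Fin n) (Fin n) F)}) := by
  apply Subalgebra.toSubmodule_injective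
  rw [← span_doubleCosetOperator_glInt_isIntegralMatrix_eq_toSubmodule_adjoin_of_commRing hϖ,
    heckeAlgebra.adjoin_doubleCosetOperator_image_eq_span (glInt n F)
      (Δ := {x : GL (Fin n) F | IsIntegralMatrix (x : Matrix (Fin n) (Fin n) F)})
      (fun a ha b hb => by
        simp only [Set.mem_setOf_eq, Units.val_mul] at ha hb ⊢
        exact ha.mul hb)
      (fun κ hκ => isIntegralMatrix_of_mem_glInt hκ)]

omit [IsDiscreteValuationRing 𝒪[F]] in
/-- `c_{ϖ^{-m} 1_n} = (c_{ϖ⁻¹ 1_n})^m` (central elements), over any `R`. [cite: Macdonald1995, Ch. V (2.5)] -/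
theorem doubleCosetOperator_zpowDiagGL_const_neg_eq_pow (hϖ : IsUniformizingElement ϖ) (m : ℕ) :
    heckeAlgebra.doubleCosetOperator (k := R) (glInt n F) (zpowDiagGL hϖ.ne_zero fun _ : Fin n => -(m : ℤ)) =
      heckeAlgebra.doubleCosetOperator (k := R) (glInt n F) (zpowDiagGL hϖ.ne_zero fun _ : Fin n => (-1 : ℤ)) ^ m := by
  induction m with
  | zero =>
    have h0 : (fun _ : Fin n => -((0 : ℕ) : ℤ)) = (0 : Fin n → ℤ) := funext fun _ => by simp
    rw [h0, zpowDiagGL_zero, heckeAlgebra.doubleCosetOperator_one, pow_zero]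
  | succ m ih =>
    have h1 : (fun _ : Fin n => -((m + 1 : ℕ) : ℤ)) = (fun _ : Fin n => (-1 : ℤ)) + fun _ : Fin n => -(m : ℤ) :=
      funext fun _ => by simp only [Pi.add_apply]; push_cast; ring
    rw [h1, zpowDiagGL_add, ← heckeAlgebra.doubleCosetOperator_central_mul (glInt n F)
      (fun x => mul_zpowDiagGL_const_comm hϖ.ne_zero (-1 : ℤ) x), ih, pow_succ']

omit [IsDiscreteValuationRing 𝒪[F]] in
/-- **MACDONALD Ch. V (2.5) over any `R`: `c_{(1ⁿ)} · c_{ϖ⁻¹ 1_n} = 1`** (`ϖ 1_n` is central).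
[cite: Macdonald1995, Ch. V (2.5)] -/
theorem doubleCosetOperator_zpowDiagGL_one_mul_neg_one_of_commRing (hϖ : IsUniformizingElement ϖ) :
    heckeAlgebra.doubleCosetOperator (k := R) (glInt n F) (zpowDiagGL hϖ.ne_zero fun _ : Fin n => (1 : ℤ)) *
        heckeAlgebra.doubleCosetOperator (k := R) (glInt n F) (zpowDiagGL hϖ.ne_zero fun _ : Fin n => (-1 : ℤ)) = 1 := by
  rw [heckeAlgebra.doubleCosetOperator_central_mul (glInt n F) (fun x => mul_zpowDiagGL_const_comm hϖ.ne_zero (1 : ℤ) x),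
    ← zpowDiagGL_add]
  have h0 : ((fun _ : Fin n => (1 : ℤ)) + fun _ : Fin n => (-1 : ℤ)) = (0 : Fin n → ℤ) := funext fun _ => by simp
  rw [h0, zpowDiagGL_zero, heckeAlgebra.doubleCosetOperator_one]

omit [IsDiscreteValuationRing 𝒪[F]] in
/-- … and `c_{ϖ⁻¹ 1_n} · c_{(1ⁿ)} = 1`, over any `R`. [cite: Macdonald1995, Ch. V (2.5)] -/
theorem doubleCosetOperator_zpowDiagGL_neg_one_mul_one_of_commRing (hϖ : IsUniformizingElement ϖ) :
    heckeAlgebra.doubleCosetOperator (k := R) (glInt n F) (zpowDiagGL hϖ.ne_zero fun _ : Fin n => (-1 : ℤ)) *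
        heckeAlgebra.doubleCosetOperator (k := R) (glInt n F) (zpowDiagGL hϖ.ne_zero fun _ : Fin n => (1 : ℤ)) = 1 := by
  rw [heckeAlgebra.doubleCosetOperator_central_mul (glInt n F) (fun x => mul_zpowDiagGL_const_comm hϖ.ne_zero (-1 : ℤ) x),
    ← zpowDiagGL_add]
  have h0 : ((fun _ : Fin n => (-1 : ℤ)) + fun _ : Fin n => (1 : ℤ)) = (0 : Fin n → ℤ) := funext fun _ => by simp
  rw [h0, zpowDiagGL_zero, heckeAlgebra.doubleCosetOperator_one]

/-- **MACDONALD Ch. V (2.5)+(2.7) INTEGRALLY: `ℋ(GL_n(F), GL_n(𝒪_F); R) = R[c_{(1)}, …, c_{(1ⁿ)}, c_{ϖ⁻¹ 1_n}]`** — the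
spherical Hecke algebra of `GL_n(F)` with coefficients in ANY commutative ring `R` is generated by the `n + 1` double
cosets of `diag(ϖ 1_r, 1_{n-r})` (`1 ≤ r ≤ n`) and `ϖ⁻¹ 1_n`, for EVERY `F` with DVR valuation ring and every uniformizer
(«`H(G, K) = H(G⁺, K)[c_{(1ⁿ)}⁻¹]`»; the tree's `adjoin_glInt_zpowDiagGL_insert_eq_top` is `R = ℂ`, g41-#4's
`adjoin_glInt_doubleCosetOperator_elementary_insert_eq_top` the case `e = f = 1`).
[cite: Macdonald1995, Ch. V (2.5), (2.7)] [cite: ShimuraIATAF1971, Thm. 3.20] -/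
theorem adjoin_glInt_zpowDiagGL_insert_eq_top_of_commRing (hϖ : IsUniformizingElement ϖ) :
    Algebra.adjoin R (insert (heckeAlgebra.doubleCosetOperator (k := R) (glInt n F) (zpowDiagGL hϖ.ne_zero fun _ : Fin n => (-1 : ℤ)))
      (Set.range fun r : Fin n => heckeAlgebra.doubleCosetOperator (k := R) (glInt n F)
        (zpowDiagGL hϖ.ne_zero fun i : Fin n => if (i : ℕ) ≤ (r : ℕ) then (1 : ℤ) else 0))) = ⊤ := by
  classical
  refine top_le_iff.1 fun T _ => ?_
  have hT := heckeAlgebra.mem_span_doubleCosetOperator (k := R) (glInt n F) T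
  refine (Submodule.span_le (p := Subalgebra.toSubmodule (Algebra.adjoin R _)).2 ?_) hT
  rintro _ ⟨γ, -, rfl⟩
  rw [SetLike.mem_coe, Subalgebra.mem_toSubmodule]
  -- `ϖ^m γ.out` is integral for some `m`, and `c_{γ.out} = c_{ϖ^{-m} 1} · c_{ϖ^m γ.out}`
  obtain ⟨m, hm⟩ := exists_zpowDiagGL_mul_isIntegralMatrix hϖ γ.out
  have hγ : heckeAlgebra.doubleCosetOperator (k := R) (glInt n F) γ.out =
      heckeAlgebra.doubleCosetOperator (k := R) (glInt n F) (zpowDiagGL hϖ.ne_zero fun _ : Fin n => -(m : ℤ)) *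
        heckeAlgebra.doubleCosetOperator (k := R) (glInt n F) (zpowDiagGL hϖ.ne_zero (fun _ : Fin n => (m : ℤ)) * γ.out) := by
    rw [heckeAlgebra.doubleCosetOperator_central_mul (glInt n F)
      (fun x => mul_zpowDiagGL_const_comm hϖ.ne_zero (-(m : ℤ)) x), ← mul_assoc, ← zpowDiagGL_add]
    have h0 : ((fun _ : Fin n => -(m : ℤ)) + fun _ : Fin n => (m : ℤ)) = (0 : Fin n → ℤ) := funext fun _ => by simp
    rw [h0, zpowDiagGL_zero, one_mul]
  show heckeAlgebra.doubleCosetOperator (k := R) (glInt n F) γ.out ∈ _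
  rw [hγ, doubleCosetOperator_zpowDiagGL_const_neg_eq_pow hϖ m]
  refine Subalgebra.mul_mem _ (Subalgebra.pow_mem _ (Algebra.subset_adjoin (Set.mem_insert _ _)) m) ?_
  exact Algebra.adjoin_mono (Set.subset_insert _ _) (doubleCosetOperator_mem_adjoin_of_isIntegralMatrix hϖ hm)

end Hecke

end Literature.NumberTheory.Automorphic

end
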